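import Literature.MathematicalPhysics.QuantumLattice.HubbardNNNHoppingEnergyDensityParticleHole
import HarnessLib

/-!
# Particle–hole IMAGE of certified box words: a word on `[U₁,U₂] × [s₁,s₂] × [n₁,n₂]` is a word on
# `[U₁,U₂] × [-s₂,-s₁] × [2-n₂,2-n₁]`, shifted by `U(n - 1)`

Family `hubbard` (topic `MathematicalPhysics/QuantumLattice`); stage S2 "certifier-families" of the Hubbard
material-oracle programme, seat `hubbard-box-p3` («box ⊂ union of certified cells ⇒ word»). The certified atlas of
the square-lattice `t–t'` Hubbard energy density `e(t, t', U, n) = energyDensityTT' t t' U n` lives at hole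
doping (`n ≤ 1`) and mostly `t' ≤ 0`; electron-doped one-band materials (NCCO, PCCO, Sr₁₋ₓLaₓCuO₂, …) arrive
from the router at `n > 1` and are READ through the particle–hole image `(t', n) ↦ (-t', 2 - n)` (downfold
router rule; oracle-api question «particle–hole image for n > 1 boxes»). The tree's exact symmetry
`energyDensityTT'_particleHole : e(t, t', U, n) = e(t, -t', U, 2 - n) + U(n - 1)` (`U ≥ 0`, `0 < n < 2`;
Lieb–Wu 2003 eq. (3)) makes that reading a KERNEL step: every cell word in the S2-seam shape
`∀ θ ∈ Set.Icc ![U₁, s₁, n₁] ![U₂, s₂, n₂], lo ≤ e(1, θ 1, θ 0, θ 2) ∧ e(1, θ 1, θ 0, θ 2) ≤ hi`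
(box-eng-2's `cw_…_word_Icc`, box-p2's kd-covers) is, verbatim, a word on the mirrored cell with the affine
shift `θ 0 · (θ 2 - 1)`, and a CONSTANT pair there after bounding the shift on the cell.

* §1 pointwise: floor / cap / window at `(t, -s, U, 2 - n)` ⇒ at `(t, s, U, n)` shifted by `U(n - 1)`
  (`energyDensityTT'_ge/le/mem_Icc_of_particleHole_image`).
* §2 the cell form with the exact (θ-dependent) shift (`energyDensityTT'_word_Icc_particleHole_image`).
* §3 constant pairs: source cell on the hole side (`n₂ ≤ 1`) ⇒ image cell on the electron side carries
  `[lo + U₁(1 - n₂), hi + U₂(1 - n₁)]` (`…_image_const_of_le_one`); source on the electron side (`1 ≤ n₁`) ⇒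
  image on the hole side carries `[lo - U₂(n₂ - 1), hi - U₁(n₁ - 1)]` (`…_image_const_of_one_le`); at half
  filling the word is EVEN in `t'` with the same pair (`energyDensityTT'_word_Icc_tPrime_reflect_halfFilling`).

Everything is PROVED; no definition, no named fact, no number. HONEST FRAMING: a relabelling of certified energy
windows; the image of the hole-doped cuprate atlas is the ELECTRON-doped `t' > 0` region (not the NCCO-class
`t' < 0, n > 1` boxes, whose images `t' > 0, n < 1` still need their own columns); nothing here is a statement
about superconductivity.

## Mathlib / tree search

REUSED: `energyDensityTT'_particleHole`, `energyDensityTT'_particleHole_one`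
(`HubbardNNNHoppingEnergyDensityParticleHole`). `lean search 'particleHole.*Icc|word_Icc.*particleHole|phImage'`:
nothing — no box-level image theorem was in the tree.

## References

* E. H. Lieb, F. Y. Wu, Physica A 321 (2003) 1, §1 eq. (3) (hole–particle symmetry of the sector energies).
  [cite: LiebWuPhysicaA2003, §1 eq. (3)]
* F. H. L. Essler et al., *The One-Dimensional Hubbard Model* (2005), §2.2.4 (Shiba / particle–hole
  transformations on bipartite lattices). [cite: EsslerEtAl2005, §2.2.4]
-/

noncomputable section

open Set

namespace Literature.MathematicalPhysics.QuantumLattice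

namespace ThermodynamicLimit

/-! ### §1 Pointwise image -/

/-- **Floor through the particle–hole image**: `lo ≤ e(t, -s, U, 2 - n)` ⇒ `lo + U(n - 1) ≤ e(t, s, U, n)`
(`U ≥ 0`, `0 < n < 2`). [cite: LiebWuPhysicaA2003, §1 eq. (3)] -/
theorem energyDensityTT'_ge_of_particleHole_image (t s : ℝ) {U : ℝ} (hU : 0 ≤ U) {n : ℝ} (hn0 : 0 < n)
    (hn2 : n < 2) {lo : ℝ} (h : lo ≤ energyDensityTT' t (-s) U (2 - n)) :
    lo + U * (n - 1) ≤ energyDensityTT' t s U n := by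
  rw [energyDensityTT'_particleHole t s hU hn0 hn2]
  linarith

/-- **Cap through the particle–hole image**: `e(t, -s, U, 2 - n) ≤ hi` ⇒ `e(t, s, U, n) ≤ hi + U(n - 1)`.
[cite: LiebWuPhysicaA2003, §1 eq. (3)] -/
theorem energyDensityTT'_le_of_particleHole_image (t s : ℝ) {U : ℝ} (hU : 0 ≤ U) {n : ℝ} (hn0 : 0 < n)
    (hn2 : n < 2) {hi : ℝ} (h : energyDensityTT' t (-s) U (2 - n) ≤ hi) :
    energyDensityTT' t s U n ≤ hi + U * (n - 1) := by
  rw [energyDensityTT'_particleHole t s hU hn0 hn2]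
  linarith

/-- **Window through the particle–hole image**: `e(t, -s, U, 2 - n) ∈ [lo, hi]` ⇒
`e(t, s, U, n) ∈ [lo + U(n - 1), hi + U(n - 1)]`. [cite: LiebWuPhysicaA2003, §1 eq. (3)] -/
theorem energyDensityTT'_mem_Icc_of_particleHole_image (t s : ℝ) {U : ℝ} (hU : 0 ≤ U) {n : ℝ} (hn0 : 0 < n)
    (hn2 : n < 2) {lo hi : ℝ} (h : energyDensityTT' t (-s) U (2 - n) ∈ Icc lo hi) :
    energyDensityTT' t s U n ∈ Icc (lo + U * (n - 1)) (hi + U * (n - 1)) :=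
  ⟨energyDensityTT'_ge_of_particleHole_image t s hU hn0 hn2 h.1,
    energyDensityTT'_le_of_particleHole_image t s hU hn0 hn2 h.2⟩

/-! ### §2 The cell form (S2-seam shape) with the exact shift -/

/-- Coordinates of a point of the mirrored cell and membership of its pre-image in the source cell.
[cite: LiebWuPhysicaA2003, §1 eq. (3)] -/
private theorem preimage_mem_Icc {U₁ U₂ s₁ s₂ n₁ n₂ : ℝ} {θ : Fin 3 → ℝ}
    (hθ : θ ∈ Icc (![U₁, -s₂, 2 - n₂] : Fin 3 → ℝ) ![U₂, -s₁, 2 - n₁]) :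
    (![θ 0, -θ 1, 2 - θ 2] : Fin 3 → ℝ) ∈ Icc (![U₁, s₁, n₁] : Fin 3 → ℝ) ![U₂, s₂, n₂] := by
  have hU₁ : U₁ ≤ θ 0 := by simpa using hθ.1 0
  have hU₂ : θ 0 ≤ U₂ := by simpa using hθ.2 0
  have ht₁ : -s₂ ≤ θ 1 := by simpa using hθ.1 1
  have ht₂ : θ 1 ≤ -s₁ := by simpa using hθ.2 1
  have hn₁ : 2 - n₂ ≤ θ 2 := by simpa using hθ.1 2
  have hn₂ : θ 2 ≤ 2 - n₁ := by simpa using hθ.2 2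
  refine ⟨fun i => ?_, fun i => ?_⟩ <;> fin_cases i <;> simp <;> linarith

/-- **PARTICLE–HOLE IMAGE OF A CELL WORD.** A certified pair on the cell
`θ = (U, t', n) ∈ [U₁,U₂] × [s₁,s₂] × [n₁,n₂]` (`U₁ ≥ 0`, `0 < n₁`, `n₂ < 2`), in the S2-seam shape
`lo ≤ e(1, θ 1, θ 0, θ 2) ≤ hi`, gives on the mirrored cell `[U₁,U₂] × [-s₂,-s₁] × [2-n₂, 2-n₁]` the pair
shifted by `θ 0 · (θ 2 - 1)`: `lo + U(n - 1) ≤ e(1, t', U, n) ≤ hi + U(n - 1)`.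
[cite: LiebWuPhysicaA2003, §1 eq. (3)] -/
theorem energyDensityTT'_word_Icc_particleHole_image {U₁ U₂ s₁ s₂ n₁ n₂ lo hi : ℝ} (hU₁ : 0 ≤ U₁)
    (hn₁ : 0 < n₁) (hn₂ : n₂ < 2)
    (h : ∀ θ ∈ Icc (![U₁, s₁, n₁] : Fin 3 → ℝ) ![U₂, s₂, n₂],
      lo ≤ energyDensityTT' 1 (θ 1) (θ 0) (θ 2) ∧ energyDensityTT' 1 (θ 1) (θ 0) (θ 2) ≤ hi) :
    ∀ θ ∈ Icc (![U₁, -s₂, 2 - n₂] : Fin 3 → ℝ) ![U₂, -s₁, 2 - n₁],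
      lo + θ 0 * (θ 2 - 1) ≤ energyDensityTT' 1 (θ 1) (θ 0) (θ 2) ∧
        energyDensityTT' 1 (θ 1) (θ 0) (θ 2) ≤ hi + θ 0 * (θ 2 - 1) := by
  intro θ hθ
  have hU : 0 ≤ θ 0 := hU₁.trans (by simpa using hθ.1 0)
  have hn0 : 0 < θ 2 := lt_of_lt_of_le (by linarith) (by simpa using hθ.1 2 : 2 - n₂ ≤ θ 2)
  have hn2 : θ 2 < 2 := lt_of_le_of_lt (by simpa using hθ.2 2 : θ 2 ≤ 2 - n₁) (by linarith)
  have hsrc := h _ (preimage_mem_Icc hθ)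
  simp only [Matrix.cons_val_zero, Matrix.cons_val_one, Matrix.head_cons, Matrix.cons_val_two,
    Matrix.tail_cons] at hsrc
  exact ⟨energyDensityTT'_ge_of_particleHole_image 1 (θ 1) hU hn0 hn2 hsrc.1,
    energyDensityTT'_le_of_particleHole_image 1 (θ 1) hU hn0 hn2 hsrc.2⟩

/-! ### §3 Constant pairs on the image cell -/

/-- **Hole-side cell ⇒ electron-side cell, constant pair.** If the source cell lies at `n ≤ 1` (`n₂ ≤ 1`,
`U₁ ≥ 0`), the image cell `[U₁,U₂] × [-s₂,-s₁] × [2-n₂, 2-n₁]` (electron side) carries the uniform pair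
`[lo + U₁(1 - n₂), hi + U₂(1 - n₁)]` (`0 ≤ U(n-1)`, monotone in both factors).
[cite: LiebWuPhysicaA2003, §1 eq. (3)] -/
theorem energyDensityTT'_word_Icc_particleHole_image_const_of_le_one {U₁ U₂ s₁ s₂ n₁ n₂ lo hi : ℝ}
    (hU₁ : 0 ≤ U₁) (hn₁ : 0 < n₁) (hn₂1 : n₂ ≤ 1)
    (h : ∀ θ ∈ Icc (![U₁, s₁, n₁] : Fin 3 → ℝ) ![U₂, s₂, n₂],
      lo ≤ energyDensityTT' 1 (θ 1) (θ 0) (θ 2) ∧ energyDensityTT' 1 (θ 1) (θ 0) (θ 2) ≤ hi) :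
    ∀ θ ∈ Icc (![U₁, -s₂, 2 - n₂] : Fin 3 → ℝ) ![U₂, -s₁, 2 - n₁],
      lo + U₁ * (1 - n₂) ≤ energyDensityTT' 1 (θ 1) (θ 0) (θ 2) ∧
        energyDensityTT' 1 (θ 1) (θ 0) (θ 2) ≤ hi + U₂ * (1 - n₁) := by
  intro θ hθ
  have hw := energyDensityTT'_word_Icc_particleHole_image hU₁ hn₁ (by linarith) h θ hθ
  have hUlo : U₁ ≤ θ 0 := by simpa using hθ.1 0
  have hUhi : θ 0 ≤ U₂ := by simpa using hθ.2 0
  have hnlo : 2 - n₂ ≤ θ 2 := by simpa using hθ.1 2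
  have hnhi : θ 2 ≤ 2 - n₁ := by simpa using hθ.2 2
  have h1 : U₁ * (1 - n₂) ≤ θ 0 * (θ 2 - 1) :=
    mul_le_mul hUlo (by linarith) (by linarith) (hU₁.trans hUlo)
  have h2 : θ 0 * (θ 2 - 1) ≤ U₂ * (1 - n₁) :=
    mul_le_mul hUhi (by linarith) (by linarith) ((hU₁.trans hUlo).trans hUhi)
  exact ⟨by linarith [hw.1], by linarith [hw.2]⟩

/-- **Electron-side cell ⇒ hole-side cell, constant pair.** If the source cell lies at `n ≥ 1` (`1 ≤ n₁`,
`n₂ < 2`, `U₁ ≥ 0`), the image cell (hole side) carries `[lo - U₂(n₂ - 1), hi - U₁(n₁ - 1)]`.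
[cite: LiebWuPhysicaA2003, §1 eq. (3)] -/
theorem energyDensityTT'_word_Icc_particleHole_image_const_of_one_le {U₁ U₂ s₁ s₂ n₁ n₂ lo hi : ℝ}
    (hU₁ : 0 ≤ U₁) (hn₁1 : 1 ≤ n₁) (hn₂ : n₂ < 2)
    (h : ∀ θ ∈ Icc (![U₁, s₁, n₁] : Fin 3 → ℝ) ![U₂, s₂, n₂],
      lo ≤ energyDensityTT' 1 (θ 1) (θ 0) (θ 2) ∧ energyDensityTT' 1 (θ 1) (θ 0) (θ 2) ≤ hi) :
    ∀ θ ∈ Icc (![U₁, -s₂, 2 - n₂] : Fin 3 → ℝ) ![U₂, -s₁, 2 - n₁],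
      lo - U₂ * (n₂ - 1) ≤ energyDensityTT' 1 (θ 1) (θ 0) (θ 2) ∧
        energyDensityTT' 1 (θ 1) (θ 0) (θ 2) ≤ hi - U₁ * (n₁ - 1) := by
  intro θ hθ
  have hw := energyDensityTT'_word_Icc_particleHole_image hU₁ (by linarith) hn₂ h θ hθ
  have hUlo : U₁ ≤ θ 0 := by simpa using hθ.1 0
  have hUhi : θ 0 ≤ U₂ := by simpa using hθ.2 0
  have hnlo : 2 - n₂ ≤ θ 2 := by simpa using hθ.1 2
  have hnhi : θ 2 ≤ 2 - n₁ := by simpa using hθ.2 2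
  have hθ0 : 0 ≤ θ 0 := hU₁.trans hUlo
  -- `θ 0 · (1 - θ 2) ∈ [U₁ (n₁ - 1), U₂ (n₂ - 1)]`
  have h1 : U₁ * (n₁ - 1) ≤ θ 0 * (1 - θ 2) :=
    mul_le_mul hUlo (by linarith) (by linarith) hθ0
  have h2 : θ 0 * (1 - θ 2) ≤ U₂ * (n₂ - 1) :=
    mul_le_mul hUhi (by linarith) (by linarith) (hθ0.trans hUhi)
  constructor <;> nlinarith [hw.1, hw.2]

/-- **At half filling the word is even in `t'`**: a pair certified on `[U₁,U₂] × [s₁,s₂] × {1}`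
(`U₁ ≥ 0`) holds verbatim on `[U₁,U₂] × [-s₂,-s₁] × {1}` (`e(t, t', U, 1) = e(t, -t', U, 1)`).
[cite: LiebWuPhysicaA2003, §1 eq. (3)] -/
theorem energyDensityTT'_word_Icc_tPrime_reflect_halfFilling {U₁ U₂ s₁ s₂ lo hi : ℝ} (hU₁ : 0 ≤ U₁)
    (h : ∀ θ ∈ Icc (![U₁, s₁, 1] : Fin 3 → ℝ) ![U₂, s₂, 1],
      lo ≤ energyDensityTT' 1 (θ 1) (θ 0) (θ 2) ∧ energyDensityTT' 1 (θ 1) (θ 0) (θ 2) ≤ hi) :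
    ∀ θ ∈ Icc (![U₁, -s₂, 1] : Fin 3 → ℝ) ![U₂, -s₁, 1],
      lo ≤ energyDensityTT' 1 (θ 1) (θ 0) (θ 2) ∧ energyDensityTT' 1 (θ 1) (θ 0) (θ 2) ≤ hi := by
  intro θ hθ
  have hθ' : θ ∈ Icc (![U₁, -s₂, 2 - 1] : Fin 3 → ℝ) ![U₂, -s₁, 2 - 1] := by norm_num; exact hθ
  have hw := energyDensityTT'_word_Icc_particleHole_image_const_of_le_one hU₁ one_pos le_rfl h θ hθ'
  simpa using hw

end ThermodynamicLimit

end Literature.MathematicalPhysics.QuantumLattice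

end
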